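import Mathlib.NumberTheory.DirichletCharacter.Basic
import Mathlib.NumberTheory.MulChar.Basic
import Literature.NumberTheory.EllipticCurves.SerreOpenImageDeterminantProofs
import Literature.NumberTheory.EllipticCurves.SupersingularDensitySerreTraceProofs
import Literature.NumberTheory.EllipticCurves.SupersingularDensitySerreFrobeniusProofs
import Literature.NumberTheory.EllipticCurves.GaloisActionProofs
import Literature.NumberTheory.EllipticCurves.LFunctionPrimeCoeff
import Literature.NumberTheory.EllipticCurves.Rank1Residual.Predicates
import Literature.NumberTheory.GaloisRepresentations.ChebotarevOpenSubgroup
import Literature.NumberTheory.GaloisRepresentations.ModNCyclotomicCharacter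
import Literature.NumberTheory.GaloisRepresentations.FramedRepTwistEulerFactorProofs
import Literature.NumberTheory.EllipticCurves.DeligneSerreWeightOneIrreducibleKroneckerWeberProofs
import HarnessLib

/-!
# Crux 19715 `ErratumRoadFive.EulerHalfNotRamNoInertSetAtFive`, line `birth`: HOLE 2 of the CM-LEVEL CUT is a THEOREM —
# a surjective `ρ̄_{E,p}` has Frobenius elements of non-zero trace in the `χ = −1` coset of every quadratic character

Width seat `bsd-line-er5-p1-w2` g2 (cell bsd-stepL), `--supports stmt-BirchSwinnertonDyer-19715`. Theorems only (no definition,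
no named fact, no `sorry`).

The ideator's line `Cruxes/EulerHalfNotRamNoInertSetAtFive/Lines/level_lowering_cut.lean` v4 §6 (bsd-idea-9 g3, THE CM-LEVEL CUT at
the Serre levels `27`, `32`, `49`) is PROVED there modulo ONE typed hypothesis, HOLE 2 =
`LevelLoweringCut.SurjInertTraceWitnessAtFive`: for `p ≥ 5`, `ρ̄_{E,p}` SURJECTIVE and a non-trivial (primitive) quadratic Dirichlet
character `χ mod m`, there are arbitrarily large primes `q` with `χ(q) = −1` and `a_q(E) ≢ 0 (mod p)`. This file proves that text
VERBATIM (`surjInertTraceWitnessAtFive_holds`; the `def` itself lives in a non-importable crux workfile, so the theorem's TYPE is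
the def's body and `(surjInertTraceWitnessAtFive_holds : SurjInertTraceWitnessAtFive)` elaborates by `δ`-unfolding there).

PROOF (Serre 1972 §5; Chebotarev). Frame `E[p] ≅ 𝔽_p²` (`exists_frame_galoisRepTorsion_rat`: `Φ : Aut(E[p]) ≅ GL₂(𝔽_p)`
compatible with traces); `Surj` makes `ρ = Φ ∘ ρ̄_{E,p} : Γ_ℚ → GL₂(𝔽_p)` onto. Let `c = χ̄_m : Γ_ℚ → (ℤ∕m)ˣ` be the mod-`m` cyclotomic
character (onto: `modNCyclotomicCharacter_rat_surjective`), `ψ = χ ∘ c` (values `±1`, so `ψ(σ²) = 1`). Pick `g₁` with `ψ(g₁) = −1` and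
`u, v` with `ρ(u) = (1 1; 0 1)`, `ρ(v) = (1 0; 1 1)`; the four elements `g₁, g₁u², g₁v², g₁u²v²` all have `ψ = −1`, and (§1, `p`
odd) one of `tr ρ(g₁)`, `tr ρ(g₁)(1 2; 0 1)`, `tr ρ(g₁)(1 0; 2 1)`, `tr ρ(g₁)(5 2; 2 1)` is non-zero (else all four entries of
`ρ(g₁)` vanish). For that `g`, Chebotarev's theorem for the open normal subgroup `N = ker ρ̄_{E,p} ∩ ker χ̄_m` (tree, PROVED:
`GaloisRepresentations.exists_isArithFrobAt_mul_inv_mem_not_mem`) gives a place `v` of `ℚ` outside any finite set with an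
arithmetic Frobenius `φ ≡ g (mod N)`; at the prime `q` under `v` (large, hence good, `≠ p`, `∤ m`):
`a_q(E) ≡ tr ρ̄_{E,p}(φ) = tr ρ(g) ≢ 0 (mod p)` (`trace_galoisRepTorsion_frobenius_eq`, Serre 1981 (238); `LFunction_apply_prime_eq_frobeniusTrace`)
and `χ(q) = χ(χ̄_m(φ)) = ψ(g) = −1` (`modNCyclotomicCharacter_eq_residueCard_of_isArithFrobAt`). `χ.IsPrimitive` is not used.

HONEST FRAMING: a kernel theorem about surjective mod-`p` images (no BSD content by itself); it discharges HOLE 2 of the ideator's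
CM-level cut, so that the `27`- and `32`-rungs of that file (`not_dvd_ordp_of_twentySevenAdditive_of_not_ram`,
`not_dvd_ordp_of_thirtyTwoAdditive_of_not_ram`) rest only on the line's existing CITABLE inputs (modularity, Diamond 1995,
Ogg–Saito) and the `49`-rung additionally on the named dimension fact `finrank_cuspForm_two_eq_genusX0 49`. Crux 19715 is NOT
closed; its residual stub is untouched here; BSD is proved for no curve; no summit statement is proved by this file.

References: [cite: Serre1972, §5.1, Thm. 2] [cite: TateGCFT1967, §2.4] [cite: Serre1981, §8.1 eq. (238) (p. 188)]
[cite: SilvermanAEC2009, III.8, V.2.3.1] [cite: Washington1997, Thm. 2.5]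
-/

noncomputable section

open scoped Classical NumberField MatrixGroups
open Matrix Field IsDedekindDomain NumberField Rat.HeightOneSpectrum Polynomial

set_option linter.dupNamespace false

namespace Summit.BirchSwinnertonDyer.BirchSwinnertonDyer.Theorems.EulerHalfSurjTraceWitness

open Literature.NumberTheory.EllipticCurves Literature.NumberTheory.GaloisRepresentations
open _root_.WeierstrassCurve

/-! ## §1 The `2 × 2` coset lemma: in `G · ⟨squares⟩` some element has non-zero trace (`2 ≠ 0`) -/

section MatrixLemma

variable {F : Type*} [Field F]

/-- **Among `G`, `G·(1 2; 0 1)`, `G·(1 0; 2 1)`, `G·(5 2; 2 1)` one matrix has non-zero trace** when `2 ≠ 0` in the field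
and `G` is invertible: the four traces are `α+δ`, `α+2γ+δ`, `α+2β+δ`, `5α+2β+2γ+δ` (`G = (α β; γ δ)`), and their joint
vanishing forces `G = 0`. [folklore] -/
theorem trace_ne_zero_or_of_det_ne_zero (h2 : (2 : F) ≠ 0) (G : Matrix (Fin 2) (Fin 2) F) (hG : G.det ≠ 0) :
    G.trace ≠ 0 ∨ (G * !![1, 2; 0, 1]).trace ≠ 0 ∨ (G * !![1, 0; 2, 1]).trace ≠ 0 ∨
      (G * !![5, 2; 2, 1]).trace ≠ 0 := by
  by_contra h
  push Not at h
  obtain ⟨h0, h1, h2', h3⟩ := h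
  have hGe : G = !![G 0 0, G 0 1; G 1 0, G 1 1] := by
    ext i j; fin_cases i <;> fin_cases j <;> rfl
  rw [hGe] at h0 h1 h2' h3 hG
  simp only [Matrix.mul_fin_two, Matrix.trace_fin_two_of] at h0 h1 h2' h3
  rw [Matrix.det_fin_two_of] at hG
  have hγ : G 1 0 = 0 := by
    have : (2 : F) * G 1 0 = 0 := by linear_combination h1 - h0
    exact (mul_eq_zero.mp this).resolve_left h2
  have hβ : G 0 1 = 0 := by
    have : (2 : F) * G 0 1 = 0 := by linear_combination h2' - h0
    exact (mul_eq_zero.mp this).resolve_left h2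
  have hα : G 0 0 = 0 := by
    have : (2 : F) * (2 * G 0 0) = 0 := by linear_combination h3 - h0 - 2 * hβ - 2 * hγ
    exact (mul_eq_zero.mp ((mul_eq_zero.mp this).resolve_left h2)).resolve_left h2
  have hδ : G 1 1 = 0 := by linear_combination h0 - hα
  exact hG (by rw [hα, hβ, hγ, hδ]; ring)

end MatrixLemma

/-! ## §2 The group-theoretic step: an element of non-zero trace in the `ψ = −1` coset of a surjective `ρ` -/

section GroupLemma

variable {Γ : Type*} [Group Γ] {F : Type*} [Field F] {R : Type*} [CommRing R]

/-- A `{0, 1, −1}`-valued multiplicative function with no zero on the group is `1` on squares. [folklore] -/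
theorem sq_val_eq_one {ψ : Γ →* R} (hψ : ∀ g, ψ g = 1 ∨ ψ g = -1) (g : Γ) : ψ (g * g) = 1 := by
  rw [map_mul]
  rcases hψ g with h | h <;> rw [h] <;> ring

/-- **In the `ψ = −1` coset of a surjective `ρ : Γ → GL₂(F)` (`2 ≠ 0` in `F`) some element has non-zero trace**, for any
`ψ : Γ →* R` with values `±1` taking the value `−1`: with `ρ u = (1 1; 0 1)`, `ρ v = (1 0; 1 1)` the elements
`g₁, g₁u², g₁v², g₁u²v²` have `ψ = ψ(g₁) = −1` and §1 applies to `G = ρ(g₁)`. [cite: Serre1972, §5.1] -/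
theorem exists_trace_ne_zero_and_eq_neg_one (h2 : (2 : F) ≠ 0)
    {ρ : Γ →* GL (Fin 2) F} (hρ : Function.Surjective ρ)
    {ψ : Γ →* R} (hψ : ∀ g, ψ g = 1 ∨ ψ g = -1) {g₁ : Γ} (hg₁ : ψ g₁ = -1) :
    ∃ g : Γ, Matrix.trace ((ρ g : GL (Fin 2) F) : Matrix (Fin 2) (Fin 2) F) ≠ 0 ∧ ψ g = -1 := by
  -- the unipotents `(1 1; 0 1)`, `(1 0; 1 1)` of `GL₂(F)` and preimages `u`, `v`
  obtain ⟨u, hu⟩ := hρ ⟨!![1, 1; 0, 1], !![1, -1; 0, 1], by simp [Matrix.one_fin_two], by simp [Matrix.one_fin_two]⟩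
  obtain ⟨v, hv⟩ := hρ ⟨!![1, 0; 1, 1], !![1, 0; -1, 1], by simp [Matrix.one_fin_two], by simp [Matrix.one_fin_two]⟩
  have hU2 : ((ρ (u * u) : GL (Fin 2) F) : Matrix (Fin 2) (Fin 2) F) = !![1, 2; 0, 1] := by
    rw [map_mul, Units.val_mul, hu]
    simp
    norm_num
  have hV2 : ((ρ (v * v) : GL (Fin 2) F) : Matrix (Fin 2) (Fin 2) F) = !![1, 0; 2, 1] := by
    rw [map_mul, Units.val_mul, hv]
    simp
    norm_num
  have hUV : ((ρ (u * u * (v * v)) : GL (Fin 2) F) : Matrix (Fin 2) (Fin 2) F) = !![5, 2; 2, 1] := by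
    rw [map_mul, Units.val_mul, hU2, hV2]
    simp
    norm_num
  set G : Matrix (Fin 2) (Fin 2) F := ((ρ g₁ : GL (Fin 2) F) : Matrix (Fin 2) (Fin 2) F) with hGdef
  have hGdet : G.det ≠ 0 := by
    rw [hGdef, ← Matrix.GeneralLinearGroup.val_det_apply]
    exact Units.ne_zero _
  have hψuu : ψ (u * u) = 1 := sq_val_eq_one hψ u
  have hψvv : ψ (v * v) = 1 := sq_val_eq_one hψ v
  rcases trace_ne_zero_or_of_det_ne_zero h2 G hGdet with h | h | h | h
  · exact ⟨g₁, h, hg₁⟩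
  · refine ⟨g₁ * (u * u), ?_, ?_⟩
    · rwa [map_mul, Units.val_mul, hU2]
    · rw [map_mul, hg₁, hψuu, mul_one]
  · refine ⟨g₁ * (v * v), ?_, ?_⟩
    · rwa [map_mul, Units.val_mul, hV2]
    · rw [map_mul, hg₁, hψvv, mul_one]
  · refine ⟨g₁ * (u * u * (v * v)), ?_, ?_⟩
    · rwa [map_mul, Units.val_mul, hUV]
    · rw [map_mul, map_mul, hg₁, hψuu, hψvv, mul_one, mul_one]

end GroupLemma

/-! ## §3 The mod-`m` cyclotomic character has open kernel -/

section Cyclotomic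

/-- The kernel of the mod-`m` cyclotomic character of `Γ_K` is open (the character is locally constant,
`modNCyclotomicCharacter_eventually_eq_one`). [folklore] -/
theorem isOpen_ker_modNCyclotomicCharacter (K : Type*) [Field K] (m : ℕ) [NeZero m] [NeZero (m : K)] :
    IsOpen ((modNCyclotomicCharacter K m).ker : Set (absoluteGaloisGroup K)) := by
  refine Subgroup.isOpen_of_mem_nhds _ (g := 1) ?_
  have h := modNCyclotomicCharacter_eventually_eq_one K m
  exact Filter.mem_of_superset h fun σ hσ => by simpa [MonoidHom.mem_ker] using hσ

end Cyclotomic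

/-! ## §4 HOLE 2 of the CM-level cut, PROVED -/

/-- **HOLE 2 (`LevelLoweringCut.SurjInertTraceWitnessAtFive`) HOLDS — text VERBATIM.** For `p ≥ 5`, `ρ̄_{E,p}` surjective,
and any non-trivial quadratic Dirichlet character `χ mod m` (primitivity is not needed): for every bound `B` there is a prime
`q > B` with `χ(q) = −1` and `a_q(E) ≢ 0 (mod p)` (`a_q = W.LFunction q`, Mathlib's `L`-series coefficient of the globally
minimal `W`). Chebotarev in `ℚ(E[p], μ_m)` (tree: `exists_isArithFrobAt_mul_inv_mem_not_mem` for `N = ker ρ̄_{E,p} ∩ ker χ̄_m`)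
applied to the element of §2; traces by `trace_galoisRepTorsion_frobenius_eq`, the character by
`modNCyclotomicCharacter_eq_residueCard_of_isArithFrobAt`.
[cite: Serre1972, §5.1, Thm. 2] [cite: TateGCFT1967, §2.4] [cite: Serre1981, §8.1 eq. (238) (p. 188)] -/
theorem surjInertTraceWitnessAtFive_holds :
    ∀ (W : WeierstrassCurve ℚ) [W.IsElliptic] [W.IsGloballyMinimal] (p : ℕ) [Fact p.Prime],
      5 ≤ p → Rank1Residual.Surj W p →
      ∀ (m : ℕ) [NeZero m] (χ : DirichletCharacter ℂ m), χ.IsQuadratic → χ.IsPrimitive → χ ≠ 1 →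
      ∀ B : ℕ, ∃ q : ℕ, q.Prime ∧ B < q ∧ χ q = -1 ∧ ((W.LFunction q : ℤ) : ZMod p) ≠ 0 := by
  intro W _ _ p _ hp5 hsurj m _ χ hquad _ hne B
  have hp : p.Prime := Fact.out
  haveI : NeZero p := ⟨hp.ne_zero⟩
  letI : Module (ZMod p) (geomTorsion W p) := AddSubgroup.torsionBy.zmodModule
  have hp2 : (2 : ZMod p) ≠ 0 := by
    intro h
    have h' : p ∣ 2 := (ZMod.natCast_eq_zero_iff 2 p).mp (by exact_mod_cast h)
    have := Nat.le_of_dvd two_pos h'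
    omega
  -- §4.1 the character `ψ = χ ∘ χ̄_m : Γ_ℚ → ℂ`, values `±1`, taking the value `−1`
  set c : absoluteGaloisGroup ℚ →* (ZMod m)ˣ := modNCyclotomicCharacter ℚ m with hcdef
  set ψ : absoluteGaloisGroup ℚ →* ℂ := (Units.coeHom ℂ).comp (χ.toUnitHom.comp c) with hψdef
  have hψ_apply : ∀ g, ψ g = χ ((c g : (ZMod m)ˣ) : ZMod m) := fun g => by
    simp only [hψdef, MonoidHom.comp_apply, Units.coeHom_apply, MulChar.coe_toUnitHom]
  have hψval : ∀ g, ψ g = 1 ∨ ψ g = -1 := by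
    intro g
    rcases hquad ((c g : (ZMod m)ˣ) : ZMod m) with h | h | h
    · exfalso
      have hne0 : χ ((c g : (ZMod m)ˣ) : ZMod m) ≠ 0 := by
        rw [← MulChar.coe_toUnitHom]; exact Units.ne_zero _
      exact hne0 h
    · exact Or.inl (by rw [hψ_apply, h])
    · exact Or.inr (by rw [hψ_apply, h])
  obtain ⟨a, ha⟩ := MulChar.ne_one_iff.mp hne
  obtain ⟨g₁, hg₁c⟩ := modNCyclotomicCharacter_rat_surjective m a
  have hg₁ : ψ g₁ = -1 := by
    rcases hψval g₁ with h | h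
    · exfalso
      have hg₁c' : c g₁ = a := hg₁c
      rw [hψ_apply, hg₁c'] at h
      exact ha h
    · exact h
  -- §4.2 frame `E[p] ≅ 𝔽_p²` and the surjective `ρ = Φ ∘ ρ̄_{E,p}`
  obtain ⟨e, Φ, -, htr, -, -, -⟩ := exists_frame_galoisRepTorsion_rat W p
  have hsurj' : Function.Surjective (galoisRepTorsion W p) := hsurj
  set ρ : absoluteGaloisGroup ℚ →* GL (Fin 2) (ZMod p) := Φ.toMonoidHom.comp (galoisRepTorsion W p)
    with hρdef
  have hρ_apply : ∀ σ, ρ σ = Φ (galoisRepTorsion W p σ) := fun σ => rfl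
  have hρsurj : Function.Surjective ρ := Φ.surjective.comp hsurj'
  -- §4.3 the element `g` of non-zero trace with `ψ g = −1`
  obtain ⟨g, hgtr, hgψ⟩ :=
    exists_trace_ne_zero_and_eq_neg_one (R := ℂ) hp2 hρsurj hψval hg₁
  -- §4.4 the open normal subgroup `N = ker ρ̄_{E,p} ⊓ ker χ̄_m`
  have hNopen : IsOpen (((galoisRepTorsion W (p : ℤ)).ker ⊓ c.ker :
      Subgroup (absoluteGaloisGroup ℚ)) : Set (absoluteGaloisGroup ℚ)) := by
    have h1 := isOpen_ker_galoisRepTorsion_holds W (n := (p : ℤ)) (by exact_mod_cast hp.ne_zero)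
    have h2 := isOpen_ker_modNCyclotomicCharacter ℚ m
    rw [Subgroup.coe_inf]
    exact h1.inter h2
  -- §4.5 the finite set of excluded places: over primes `≤ B' = B + p + m + (max bad prime)`
  have hbadfin := W.finite_setOf_prime_not_hasGoodReductionAtPrime
  set B' : ℕ := B + p + m + hbadfin.toFinset.sup id with hB'def
  set S : Set (HeightOneSpectrum (𝓞 ℚ)) := {v | ((primesEquiv v : Nat.Primes) : ℕ) ≤ B'} with hSdef
  have hSfin : S.Finite := by
    refine Set.Finite.of_finite_image (f := fun v => ((primesEquiv v : Nat.Primes) : ℕ)) ?_ ?_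
    · exact (Set.finite_Iic B').subset (by rintro _ ⟨v, hv, rfl⟩; exact hv)
    · exact (Subtype.val_injective.comp primesEquiv.injective).injOn
  -- §4.6 Chebotarev: a place `v ∉ S` with an arithmetic Frobenius `φ ≡ g (mod N)`
  obtain ⟨v, hvS, -, 𝔓, h𝔓, φ, hφ, hφg⟩ :=
    exists_isArithFrobAt_mul_inv_mem_not_mem ℚ ((galoisRepTorsion W (p : ℤ)).ker ⊓ c.ker) hNopen g S hSfin
  set q : ℕ := ((primesEquiv v : Nat.Primes) : ℕ) with hqdef
  have hqprime : q.Prime := (primesEquiv v).2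
  haveI : Fact q.Prime := ⟨hqprime⟩
  have hqB' : B' < q := by simpa [hSdef] using hvS
  have hqB : B < q := by omega
  have hqp : q ≠ p := by omega
  have hqm : ¬ q ∣ m := fun h => by
    have := Nat.le_of_dvd (NeZero.pos m) h
    omega
  have hgood : W.HasGoodReductionAtPrime q := by
    by_contra hbad
    have hmem : q ∈ hbadfin.toFinset := hbadfin.mem_toFinset.mpr ⟨⟨hqprime⟩, hbad⟩
    have : q ≤ hbadfin.toFinset.sup id := by simpa using Finset.le_sup (f := id) hmem
    omega
  -- §4.7 `φ ≡ g (mod N)`: same action on `E[p]`, same cyclotomic character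
  have hmemN : φ * g⁻¹ ∈ (galoisRepTorsion W (p : ℤ)).ker ⊓ c.ker := hφg
  rw [Subgroup.mem_inf, MonoidHom.mem_ker, MonoidHom.mem_ker, map_mul, map_inv, mul_inv_eq_one,
    map_mul, map_inv, mul_inv_eq_one] at hmemN
  obtain ⟨hρeq, hceq⟩ := hmemN
  -- §4.8 the trace: `a_q ≡ tr ρ̄(φ) = tr ρ(g) ≢ 0 (mod p)`
  have htrφ : Matrix.trace ((ρ φ : GL (Fin 2) (ZMod p)) : Matrix (Fin 2) (Fin 2) (ZMod p)) =
      (W.frobeniusTrace q : ZMod p) := by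
    rw [hρ_apply, htr, W.trace_galoisRepTorsion_frobenius_eq p hqp hgood (v := v) hqdef.symm h𝔓 hφ]
  have hρφg : ρ φ = ρ g := by rw [hρ_apply, hρ_apply, hρeq]
  have haq : ((W.LFunction q : ℤ) : ZMod p) ≠ 0 := by
    rw [LFunction_apply_prime_eq_frobeniusTrace W q hgood, ← htrφ, hρφg]
    exact hgtr
  -- §4.9 the character: `χ(q) = χ(χ̄_m(φ)) = ψ(g) = −1`
  have hm𝔓 : (m : absIntegers (𝓞 ℚ) ℚ) ∉ 𝔓 :=
    Rat.natCast_not_mem_of_mem_primesAbove_of_not_dvd h𝔓 hqm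
  have hcφ : ((c φ : (ZMod m)ˣ) : ZMod m) = (q : ZMod m) := by
    rw [hcdef, modNCyclotomicCharacter_eq_residueCard_of_isArithFrobAt h𝔓 hm𝔓 hφ,
      FramedRep.residueCard_eq_coe_primesEquiv']
  have hχq : χ (q : ZMod m) = -1 := by
    rw [← hcφ, hceq, ← hψ_apply]
    exact hgψ
  exact ⟨q, hqprime, hqB, hχq, haq⟩

end Summit.BirchSwinnertonDyer.BirchSwinnertonDyer.Theorems.EulerHalfSurjTraceWitness

end
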